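import Summits.FinalStateConjecture.FinalStateConjecture.Theorems.StarvedNecksGapDecaySufficesStubAssemblyDefs

/-!
# Line `Sketch` of crux `GapDecaySuffices` — skeleton v10 DEFINITIONS (lead c2)

Verbatim Theorems-side copies of the v10 bundles of the lead's skeleton
`Cruxes/GapDecaySuffices/Lines/Sketch.lean` (a Theorems file cannot import `Cruxes`).  v10 = v9 plus the
three interface repairs found by the wave-2 workers of lead c1 (crux `NOTES.md`, F11/F13) and the lead's
S3-agnostic assembly:

* `TubeAnchoredClockR` — radius-windowed anchoring WITH A COARSE TWO-SIDED CLOCK WINDOW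
  `y⁰ ≤ C (tᵢ x + 1) ∧ tᵢ x ≤ C (y⁰ + 1)` (F11: without it the late seed of S4″b has no typed handle when
  `ρᵢ → ∞`; physically free for every capture theorem).  `LabelMatching` (v10) outputs it; the S4 chain
  `AnchoredLocationP` / `SeededLocationP` / `LateSeed` (v10) consumes it; `tubeAnchoredR_of_clock` projects
  it to the v9 `TubeAnchoredR` for the consumers that keep the v9 form (`UniformLocation`,
  `CertificateBookkeeping`).
* `SwitchOffInward` (v10) — the target box `𝒯` and the smoothness region of `Bm`, `h₂` get their own
  floor `τB ≤ τA` (F13: a located but lagging clock makes `MapsTo T 𝒞 𝒯` with one floor unsatisfiable).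
* `PerHoleRegaugeCore` — (A) without its two leading hypotheses, so that the assembly can be stated for an
  arbitrary analytic core `S3 : Prop` (`…StubAssemblyV10.assembly_of_core`); `PerHoleRegauge` (v10) :=
  `FlatFarCertified → SwitchOffInward → PerHoleRegaugeCore`.

No `sorry`, standard axioms; statement bundles only (plus one projection lemma).
-/
noncomputable section

open scoped Manifold ContDiff Topology ENNReal
open Filter Set Topology Literature.Geometry.Lorentzian

namespace Summit.FinalStateConjecture.FinalStateConjecture.Theorems.GapDecaySuffices.V10

-- justified lint debt: the problem namespace repeats the summit name (`FinalStateConjecture.FinalStateConjecture`)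
set_option linter.dupNamespace false

open Location.AnchoredV2 (HonestCore HonestFar DistinctVelocities TubeAnchoredR)
open Relabel (ParityDatum relabelMotion relabelChart relabelEach)
open Assembly (FlatFarCertified pullbackMinus GapCert Located AdmissibleProfile SingleHoleCert)

/-! ## Anchoring with a coarse clock window -/

/-- **`TubeAnchoredClockR d R₀`** (v10 anchoring clause = the misstatement boundary `Hf`(4) of the crux,
F11 form): `TubeAnchoredR` (eventually in flat time, the flat image of the model collar
`3ρᵢ(y⁰) + 2R₀ ≤ rᵢ y ≤ 4ρᵢ(y⁰) + 2R₀` is the input hole chart `i`'s image of a late point of its honest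
cell with model radius in `[R₀, 9ρᵢ(y⁰) + 3R₀]`) PLUS a coarse two-sided comparison of the flat clock of
`y` and the hole clock of its anchored preimage `x`: `y⁰ ≤ C (tᵢ x + 1)` and `tᵢ x ≤ C (y⁰ + 1)`. -/
def TubeAnchoredClockR {𝓢 : Spacetime.{0} 4} {O : Set 𝓢.carrier} {k : ℕ}
    (d : FinalStateDecomposition 𝓢 O k) (R₀ : ℝ) : Prop :=
  ∀ i, ∃ T C : ℝ, ∀ y : d.flatDomain, T ≤ y.1 0 →
    3 * d.excision i (y.1 0) + 2 * R₀ ≤ (d.background i).radius y.1 →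
    (d.background i).radius y.1 ≤ 4 * d.excision i (y.1 0) + 2 * R₀ →
      ∃ x : (d.background i).domain, d.chart i x = d.flatChart y ∧
        d.τ₀ < (d.background i).time x.1 ∧ R₀ ≤ (d.background i).radius x.1 ∧
        (d.background i).radius x.1 ≤ 9 * d.excision i (y.1 0) + 3 * R₀ ∧
        (∀ j, j ≠ i → (d.background i).radius x.1 ≤ (d.background j).radius x.1) ∧
        y.1 0 ≤ C * ((d.background i).time x.1 + 1) ∧ (d.background i).time x.1 ≤ C * (y.1 0 + 1)

/-- The v10 anchoring clause projects to the v9 `TubeAnchoredR` (drop the clock window). -/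
theorem tubeAnchoredR_of_clock {𝓢 : Spacetime.{0} 4} {O : Set 𝓢.carrier} {k : ℕ}
    (d : FinalStateDecomposition 𝓢 O k) (R₀ : ℝ) (h : TubeAnchoredClockR d R₀) :
    TubeAnchoredR d R₀ := by
  intro i
  obtain ⟨T, C, hT⟩ := h i
  refine ⟨T, fun y hy h3 h4 ↦ ?_⟩
  obtain ⟨x, hx, ht, hR, hr, hcell, -, -⟩ := hT y hy h3 h4
  exact ⟨x, hx, ht, hR, hr, hcell⟩

/-! ## S3, v10 -/

/-- **(S3, two-metric form, v10) Inward switch-off** — v9 with a separate floor `τB ≤ τA` for the target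
box `𝒯 = {τB < y⁰, |y̲| < 2σ(y⁰)}` and for the region `{τB < y⁰, rin(y⁰)/2 < |y̲|}` where `Bm`, `h₂` are
smooth (the collar `𝒞` and the work box `𝒵` keep `τA`, `τA'`). -/
def SwitchOffInward : Prop :=
  ∀ (τA τB : ℝ) (rin σ κ : ℝ → ℝ) (T : E4 → E4) (h₁ h₂ Bm : E4 → E4 →L[ℝ] E4 →L[ℝ] ℝ),
    τB ≤ τA → ContDiff ℝ ∞ rin → ContDiff ℝ ∞ σ →
    (∀ τ, |deriv rin τ| ≤ 1 ∧ |deriv σ τ| ≤ 1 ∧ 1 ≤ rin τ ∧ rin τ ≤ σ τ) →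
    Tendsto (fun τ ↦ σ τ / rin τ) atTop atTop →
    Tendsto κ atTop (𝓝 0) →
    ContDiffOn ℝ ∞ (fun p : E4 × E4 ↦ Bm p.1 p.2)
      ({y | τB < y 0 ∧ rin (y 0) / 2 < E4.spatialNorm y} ×ˢ univ) →
    ContDiffOn ℝ ∞ (fun p : E4 × E4 ↦ h₂ p.1 p.2)
      ({y | τB < y 0 ∧ rin (y 0) / 2 < E4.spatialNorm y} ×ˢ univ) →
    (let 𝒞 : Set E4 :=
        {x | τA < x 0 ∧ 3 / 4 * σ (x 0) < E4.spatialNorm x ∧ E4.spatialNorm x < 7 / 4 * σ (x 0)};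
      let 𝒯 : Set E4 := {y | τB < y 0 ∧ E4.spatialNorm y < 2 * σ (y 0)};
      ContDiffOn ℝ ∞ T 𝒞 ∧ InjOn T 𝒞 ∧ MapsTo T 𝒞 𝒯 ∧
      (∀ x ∈ 𝒞, 0 < LinearMap.det (fderiv ℝ T x : E4 →ₗ[ℝ] E4) ∧ 0 < fderiv ℝ T x (E4.basisVector 0) 0) ∧
      (∀ x ∈ 𝒞, |E4.spatialNorm (T x) - E4.spatialNorm x| ≤ κ (x 0) * σ (x 0) ∧
        |T x 0 - x 0| ≤ κ (x 0) * σ (x 0)) ∧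
      (∀ x ∈ 𝒞, ∀ v w : E4,
        (Bm (T x) + h₂ (T x)) (fderiv ℝ T x v) (fderiv ℝ T x w) = (Minkowski.bilin + h₁ x) v w) ∧
      Tendsto (fun τ ↦ supCkENorm {x | x ∈ 𝒞 ∧ x 0 = τ} 2 h₁) atTop (𝓝 0) ∧
      Tendsto (fun τ ↦ supCkENorm {y | y ∈ 𝒯 ∧ y 0 = τ} 2 h₂) atTop (𝓝 0) ∧
      Tendsto (fun τ ↦ supCkENorm {y | y ∈ 𝒯 ∧ y 0 = τ ∧ rin τ / 2 ≤ E4.spatialNorm y} 2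
        (fun y ↦ Bm y - Minkowski.bilin)) atTop (𝓝 0)) →
    ∃ (τA' : ℝ) (κ' : ℝ → ℝ) (S : E4 → E4),
      let 𝒵 : Set E4 := {x | τA' < x 0 ∧ E4.spatialNorm x < 7 / 4 * σ (x 0)};
      let 𝒯 : Set E4 := {y | τB < y 0 ∧ E4.spatialNorm y < 2 * σ (y 0)};
      τA ≤ τA' ∧ Tendsto κ' atTop (𝓝 0) ∧
      ContDiffOn ℝ ∞ S 𝒵 ∧ InjOn S 𝒵 ∧ IsOpenMap (𝒵.restrict S) ∧ MapsTo S 𝒵 𝒯 ∧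
      (∀ x ∈ 𝒵, E4.spatialNorm x ≤ rin (x 0) → S x = x) ∧
      (∀ x ∈ 𝒵, 3 / 2 * σ (x 0) ≤ E4.spatialNorm x → S x = T x) ∧
      (∀ x ∈ 𝒵, |E4.spatialNorm (S x) - E4.spatialNorm x| ≤ κ' (x 0) * σ (x 0) ∧
        |S x 0 - x 0| ≤ κ' (x 0) * σ (x 0)) ∧
      Tendsto (fun τ ↦ supCkENorm {x | x ∈ 𝒵 ∧ x 0 = τ} 2
        (pullbackMinus (fun y ↦ Bm y + h₂ y) S Bm)) atTop (𝓝 0)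

/-! ## Label matching, v10 (outputs the clock window) -/

/-- **Label matching, v10**: as v8/v9 (`…Assembly.LabelMatching`) but the relabelled output is anchored
WITH the coarse clock window (`TubeAnchoredClockR`).  Still the documented misstatement boundary of the
crux (no typed handle in `Hc`/`Hf`/DV; one line from the proposed input clause `Hf`(4)). -/
def LabelMatching : Prop :=
  ∀ (X : Type) [TopologicalSpace X] [ChartedSpace E3 X] [IsManifold (𝓡 3) ∞ X] [ConnectedSpace X]
    (D : InitialDataSet (𝓡 3) X), D ∈ admissibleVacuumData X →
    ∀ 𝒟 : VacuumCauchyDevelopment D, 𝒟.IsMaximal →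
    ∀ (O : Set 𝒟.carrier) (d : FinalStateDecomposition 𝒟.toSpacetime O 4) (R₀ : ℝ),
      O = exteriorOf 𝒟.toCauchyDevelopment d.charted →
      HonestCore 𝒟.toSpacetime O 4 d R₀ → HonestFar 𝒟.toSpacetime O 4 d R₀ →
      DistinctVelocities 𝒟.toSpacetime O 4 d →
      ∃ (d' : FinalStateDecomposition 𝒟.toSpacetime O 4) (R₀' : ℝ),
        d'.charted = d.charted ∧ d'.N = d.N ∧ d'.flatDomain = d.flatDomain ∧
          (∀ (y : E4) (hy : y ∈ d.flatDomain) (hy' : y ∈ d'.flatDomain),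
            d'.flatChart ⟨y, hy'⟩ = d.flatChart ⟨y, hy⟩) ∧
          HonestCore 𝒟.toSpacetime O 4 d' R₀' ∧ HonestFar 𝒟.toSpacetime O 4 d' R₀' ∧
          DistinctVelocities 𝒟.toSpacetime O 4 d' ∧ TubeAnchoredClockR d' R₀' ∧
          (∀ i, ∀ᶠ s in atTop, 0 ≤ d'.excision i s)

/-! ## The S4 chain, v10 (consumes the clock window) -/

/-- **(S4, v10) Anchored location** — `…Location.AnchoredP.AnchoredLocationP` with the anchoring
hypothesis `TubeAnchoredClockR`. -/
def AnchoredLocationP : Prop :=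
  ∀ (X : Type) [TopologicalSpace X] [ChartedSpace E3 X] [IsManifold (𝓡 3) ∞ X] [ConnectedSpace X]
    (D : InitialDataSet (𝓡 3) X), D ∈ admissibleVacuumData X →
    ∀ 𝒟 : VacuumCauchyDevelopment D, 𝒟.IsMaximal →
    ∀ (O : Set 𝒟.carrier) (d : FinalStateDecomposition 𝒟.toSpacetime O 4) (R₀ : ℝ),
      O = exteriorOf 𝒟.toCauchyDevelopment d.charted →
      HonestCore 𝒟.toSpacetime O 4 d R₀ → HonestFar 𝒟.toSpacetime O 4 d R₀ →
      DistinctVelocities 𝒟.toSpacetime O 4 d → TubeAnchoredClockR d R₀ →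
      ∀ i : Fin d.N, (∀ᶠ s in atTop, 0 ≤ d.excision i s) →
      ∃ Bk : ℝ → ℝ, Tendsto (fun s ↦ Bk s / s) atTop (𝓝 0) ∧
      ∀ (ρ' : ℝ → ℝ), Monotone ρ' → Continuous ρ' → ConcaveOn ℝ (Set.Ici 0) ρ' →
        Tendsto (fun s ↦ ρ' s / s) atTop (𝓝 0) →
        Tendsto (fun s ↦ Bk s / ρ' s) atTop (𝓝 0) → (∀ s, 1 ≤ ρ' s) →
      ∀ (R₁ τ₁ : ℝ) (W : ℝ → ℝ) (Ψg : (d.background i).domain → 𝒟.carrier),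
        let B := d.background i; let t := B.time; let r := B.radius;
        R₀ ≤ R₁ → d.τ₀ ≤ τ₁ → Continuous W → (∀ s, τ₁ ≤ s → 3 * ρ' s + 2 ≤ W s) →
        (let U : Set B.domain := {x | τ₁ < t x.1 ∧ r x.1 < W (x.1 0) + 1};
          ContMDiffOn 𝓘(ℝ, E4) (𝓡 4) ∞ Ψg U ∧ Topology.IsOpenEmbedding (U.restrict Ψg) ∧
            Ψg '' U ⊆ d.charted) →
        (∀ x : B.domain, r x.1 ≤ R₁ + 1 → Ψg x = d.chart i x) →
        Tendsto (fun τ ↦ supCkENorm (Subtype.val '' {x : B.domain | t x.1 = τ ∧ r x.1 ≤ W (x.1 0)}) 2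
          (𝒟.toSpacetime.deviationExtend B Ψg)) atTop (𝓝 0) →
        (∀ x : B.domain, τ₁ ≤ t x.1 → R₁ ≤ r x.1 → r x.1 ≤ W (x.1 0) →
          𝒟.toSpacetime.timeOrientation.IsFutureDirected
            (mfderiv 𝓘(ℝ, E4) (𝓡 4) Ψg x (((d.motion i).1 : E4 ≃L[ℝ] E4) (E4.basisVector 0)))) →
        (∀ (τ' : ℝ) (ϱ : ℝ → ℝ), Continuous ϱ → τ₁ < τ' →
          (∀ x : B.domain, τ' ≤ t x.1 → r x.1 ≤ ϱ (t x.1) → r x.1 ≤ W (x.1 0)) →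
          closure (Ψg '' {x | τ' ≤ t x.1 ∧ r x.1 ≤ ϱ (t x.1)}) ∩ O ⊆
            Ψg '' {x | τ' ≤ t x.1 ∧ r x.1 ≤ ϱ (t x.1)}) →
        ∃ (τ₂ : ℝ) (κ : ℝ → ℝ), τ₁ ≤ τ₂ ∧ Tendsto κ atTop (𝓝 0) ∧
          ∀ (y : E4) (hy : y ∈ B.domain), τ₂ < t y → 11 / 10 * ρ' (y 0) ≤ r y →
            r y ≤ 29 / 10 * ρ' (y 0) →
            ∃ hy' : y ∈ d.flatDomain, d.τ₀ < y 0 ∧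
              (∀ j, d.excision j (y 0) + 1 ≤ (d.background j).radius y) ∧
              ∃ x : B.domain, τ₁ < t x.1 ∧ r x.1 < W (x.1 0) ∧ Ψg x = d.flatChart ⟨y, hy'⟩ ∧
                |t x.1 - t y| ≤ κ (t y) * ρ' (y 0) ∧ |r x.1 - r y| ≤ κ (t y) * ρ' (y 0)

/-- **(S4′, v10) Seeded location** — `…Location.AnchoredP.SeededLocationP` with the anchoring hypothesis
`TubeAnchoredClockR`. -/
def SeededLocationP : Prop :=
  ∀ (X : Type) [TopologicalSpace X] [ChartedSpace E3 X] [IsManifold (𝓡 3) ∞ X] [ConnectedSpace X]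
    (D : InitialDataSet (𝓡 3) X), D ∈ admissibleVacuumData X →
    ∀ 𝒟 : VacuumCauchyDevelopment D, 𝒟.IsMaximal →
    ∀ (O : Set 𝒟.carrier) (d : FinalStateDecomposition 𝒟.toSpacetime O 4) (R₀ : ℝ),
      O = exteriorOf 𝒟.toCauchyDevelopment d.charted →
      HonestCore 𝒟.toSpacetime O 4 d R₀ → HonestFar 𝒟.toSpacetime O 4 d R₀ →
      DistinctVelocities 𝒟.toSpacetime O 4 d → TubeAnchoredClockR d R₀ →
      ∀ i : Fin d.N, (∀ᶠ s in atTop, 0 ≤ d.excision i s) →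
      ∃ Bk : ℝ → ℝ, Tendsto (fun s ↦ Bk s / s) atTop (𝓝 0) ∧
      ∀ (ρ' : ℝ → ℝ), Monotone ρ' → Continuous ρ' → ConcaveOn ℝ (Set.Ici 0) ρ' →
        Tendsto (fun s ↦ ρ' s / s) atTop (𝓝 0) →
        Tendsto (fun s ↦ Bk s / ρ' s) atTop (𝓝 0) → (∀ s, 1 ≤ ρ' s) →
      ∀ (R₁ τ₁ : ℝ) (W : ℝ → ℝ) (Ψg : (d.background i).domain → 𝒟.carrier),
        let B := d.background i; let t := B.time; let r := B.radius;
        R₀ ≤ R₁ → d.τ₀ ≤ τ₁ → Continuous W → (∀ s, τ₁ ≤ s → 3 * ρ' s + 2 ≤ W s) →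
        (let U : Set B.domain := {x | τ₁ < t x.1 ∧ r x.1 < W (x.1 0) + 1};
          ContMDiffOn 𝓘(ℝ, E4) (𝓡 4) ∞ Ψg U ∧ Topology.IsOpenEmbedding (U.restrict Ψg) ∧
            Ψg '' U ⊆ d.charted) →
        (∀ x : B.domain, r x.1 ≤ R₁ + 1 → Ψg x = d.chart i x) →
        Tendsto (fun τ ↦ supCkENorm (Subtype.val '' {x : B.domain | t x.1 = τ ∧ r x.1 ≤ W (x.1 0)}) 2
          (𝒟.toSpacetime.deviationExtend B Ψg)) atTop (𝓝 0) →
        (∀ x : B.domain, τ₁ ≤ t x.1 → R₁ ≤ r x.1 → r x.1 ≤ W (x.1 0) →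
          𝒟.toSpacetime.timeOrientation.IsFutureDirected
            (mfderiv 𝓘(ℝ, E4) (𝓡 4) Ψg x (((d.motion i).1 : E4 ≃L[ℝ] E4) (E4.basisVector 0)))) →
        (∀ (τ' : ℝ) (ϱ : ℝ → ℝ), Continuous ϱ → τ₁ < τ' →
          (∀ x : B.domain, τ' ≤ t x.1 → r x.1 ≤ ϱ (t x.1) → r x.1 ≤ W (x.1 0)) →
          closure (Ψg '' {x | τ' ≤ t x.1 ∧ r x.1 ≤ ϱ (t x.1)}) ∩ O ⊆
            Ψg '' {x | τ' ≤ t x.1 ∧ r x.1 ≤ ϱ (t x.1)}) →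
        ∃ (T τ' : ℝ) (ϱ rs κ : ℝ → ℝ), τ₁ < τ' ∧ Continuous ϱ ∧ Tendsto κ atTop (𝓝 0) ∧
          (∀ x : B.domain, τ' ≤ t x.1 → r x.1 ≤ ϱ (t x.1) → r x.1 < W (x.1 0)) ∧
          (∀ s, T ≤ s → R₀ ≤ rs s ∧ d.excision i s < rs s ∧ rs s < 11 / 10 * ρ' s) ∧
          (∀ (z : E4) (hz : z ∈ d.flatDomain), T ≤ z 0 → r z = rs (z 0) →
            ∃ x : B.domain, τ' < t x.1 ∧ r x.1 < ϱ (t x.1) ∧ Ψg x = d.flatChart ⟨z, hz⟩) ∧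
          (∀ (z : E4) (hz : z ∈ d.flatDomain), T ≤ z 0 → rs (z 0) ≤ r z →
            r z ≤ 29 / 10 * ρ' (z 0) →
            ∀ x : B.domain, τ' ≤ t x.1 → r x.1 ≤ ϱ (t x.1) → Ψg x = d.flatChart ⟨z, hz⟩ →
              τ' < t x.1 ∧ r x.1 < ϱ (t x.1)) ∧
          (∀ (z : E4) (hz : z ∈ d.flatDomain), T ≤ z 0 → 11 / 10 * ρ' (z 0) ≤ r z →
            r z ≤ 29 / 10 * ρ' (z 0) →
            ∀ x : B.domain, τ' < t x.1 → r x.1 < ϱ (t x.1) → Ψg x = d.flatChart ⟨z, hz⟩ →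
              |t x.1 - t z| ≤ κ (t z) * ρ' (z 0) ∧ |r x.1 - r z| ≤ κ (t z) * ρ' (z 0))

/-- **(S4″b, v10) Late seed** — `…Location.Seeded.LateSeed` with the anchoring hypothesis
`TubeAnchoredClockR` (the clock window gives lateness of the anchored preimage when `ρᵢ → ∞`, F11). -/
def LateSeed : Prop :=
  ∀ (X : Type) [TopologicalSpace X] [ChartedSpace E3 X] [IsManifold (𝓡 3) ∞ X] [ConnectedSpace X]
    (D : InitialDataSet (𝓡 3) X), D ∈ admissibleVacuumData X →
    ∀ 𝒟 : VacuumCauchyDevelopment D, 𝒟.IsMaximal →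
    ∀ (O : Set 𝒟.carrier) (d : FinalStateDecomposition 𝒟.toSpacetime O 4) (R₀ : ℝ),
      O = exteriorOf 𝒟.toCauchyDevelopment d.charted →
      HonestCore 𝒟.toSpacetime O 4 d R₀ → HonestFar 𝒟.toSpacetime O 4 d R₀ →
      DistinctVelocities 𝒟.toSpacetime O 4 d → TubeAnchoredClockR d R₀ →
      ∀ i : Fin d.N, (∀ᶠ s in atTop, 0 ≤ d.excision i s) →
      ∃ Bk : ℝ → ℝ, Tendsto (fun s ↦ Bk s / s) atTop (𝓝 0) ∧
      ∀ (ρ' : ℝ → ℝ), Monotone ρ' → Continuous ρ' → ConcaveOn ℝ (Set.Ici 0) ρ' →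
        Tendsto (fun s ↦ ρ' s / s) atTop (𝓝 0) →
        Tendsto (fun s ↦ Bk s / ρ' s) atTop (𝓝 0) → (∀ s, 1 ≤ ρ' s) →
      ∀ (R₁ τ₁ : ℝ) (W : ℝ → ℝ) (Ψg : (d.background i).domain → 𝒟.carrier),
        let B := d.background i; let t := B.time; let r := B.radius;
        R₀ ≤ R₁ → d.τ₀ ≤ τ₁ → Continuous W → (∀ s, τ₁ ≤ s → 3 * ρ' s + 2 ≤ W s) →
        (let U : Set B.domain := {x | τ₁ < t x.1 ∧ r x.1 < W (x.1 0) + 1};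
          ContMDiffOn 𝓘(ℝ, E4) (𝓡 4) ∞ Ψg U ∧ Topology.IsOpenEmbedding (U.restrict Ψg) ∧
            Ψg '' U ⊆ d.charted) →
        (∀ x : B.domain, r x.1 ≤ R₁ + 1 → Ψg x = d.chart i x) →
        Tendsto (fun τ ↦ supCkENorm (Subtype.val '' {x : B.domain | t x.1 = τ ∧ r x.1 ≤ W (x.1 0)}) 2
          (𝒟.toSpacetime.deviationExtend B Ψg)) atTop (𝓝 0) →
        (∀ x : B.domain, τ₁ ≤ t x.1 → R₁ ≤ r x.1 → r x.1 ≤ W (x.1 0) →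
          𝒟.toSpacetime.timeOrientation.IsFutureDirected
            (mfderiv 𝓘(ℝ, E4) (𝓡 4) Ψg x (((d.motion i).1 : E4 ≃L[ℝ] E4) (E4.basisVector 0)))) →
        (∀ (τ' : ℝ) (ϱ : ℝ → ℝ), Continuous ϱ → τ₁ < τ' →
          (∀ x : B.domain, τ' ≤ t x.1 → r x.1 ≤ ϱ (t x.1) → r x.1 ≤ W (x.1 0)) →
          closure (Ψg '' {x | τ' ≤ t x.1 ∧ r x.1 ≤ ϱ (t x.1)}) ∩ O ⊆
            Ψg '' {x | τ' ≤ t x.1 ∧ r x.1 ≤ ϱ (t x.1)}) →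
        ∀ T τ₂ : ℝ, ∃ (z : E4) (hz : z ∈ d.flatDomain), T ≤ z 0 ∧
          3 * d.excision i (z 0) + 2 * R₀ ≤ r z ∧ r z ≤ 4 * d.excision i (z 0) + 2 * R₀ ∧
          ∃ x : B.domain, τ₂ ≤ t x.1 ∧ r x.1 ≤ W (x.1 0) ∧ Ψg x = d.flatChart ⟨z, hz⟩

/-! ## (A), v10: core form and the S3-fed form -/

/-- **(A) Per-hole re-gauge with parity decision, CORE form** — `…Assembly.PerHoleRegauge` without its two
leading hypotheses `FlatFarCertified → SwitchOffInward →` (the geometric construction for one hole, given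
an admissible profile, a gap certificate above `3·(16ρ') + 2` and the located wide collar). -/
def PerHoleRegaugeCore : Prop :=
  ∀ (𝓢 : Spacetime.{0} 4) (O : Set 𝓢.carrier) (d : FinalStateDecomposition 𝓢 O 4) (R₀ : ℝ) (i : Fin d.N)
    (ρ' : ℝ → ℝ) (τm R₁ τ₁ τ₂ : ℝ) (W κ : ℝ → ℝ) (Ψg : (d.background i).domain → 𝓢.carrier),
    HonestCore 𝓢 O 4 d R₀ → HonestFar 𝓢 O 4 d R₀ → DistinctVelocities 𝓢 O 4 d →
    AdmissibleProfile d R₀ i ρ' τm →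
    GapCert d R₀ i (fun s ↦ 3 * (16 * ρ' s) + 2) R₁ τ₁ W Ψg →
    τ₁ ≤ τ₂ → Tendsto κ atTop (𝓝 0) → Located d i ρ' τ₁ W Ψg τ₂ κ (11 / 10) 46 →
    ∃ (P : ParityDatum (d.motion i).1) (τn : ℝ) (Rc κ' : ℝ → ℝ)
      (Ψa : (boostedKerrBackground (relabelMotion P) (d.motion i).2 (d.mass i) (d.spin i)).domain →
        𝓢.carrier), SingleHoleCert d R₀ i P ρ' τ₁ W Ψg τn Rc κ' Ψa

/-- **(A), v10**: the core form fed by S2 and the v10 S3. -/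
def PerHoleRegauge : Prop :=
  FlatFarCertified → SwitchOffInward → PerHoleRegaugeCore

end Summit.FinalStateConjecture.FinalStateConjecture.Theorems.GapDecaySuffices.V10

end
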